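import Summits.CriticalPhenomena.PercolationContinuityZ3.Theorems.PercNearOneGluingNoHeavyLowerTailThreePointHubGraphs
import Summits.CriticalPhenomena.PercolationContinuityZ3.Theorems.PercNearOneGluingNoHeavyLowerTailThreePointPlusIsoProduct
import HarnessLib

/-!
# THEOREM H⁺: the sharpened three-point row `(3PT+)` on every hub graph, all weights

Support file for crux `stmt-CriticalPhenomena-4575` (`NoHeavyLowerTail`), lane `prim-facecert` gen 18
(`--supports stmt-CriticalPhenomena-4575`).  Memos: `run/shared/lean/prim/prim-l12/FROM-prim-nh-lead-4575-g112-3PTPLUS-HUB.md`,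
`run/shared/lean/prim/prim-l12/prim-facecert/FINDING-gen18-HUB-STEP-CERTIFICATE.md`.

Bond percolation `μ = prodBernoulli w` on a finite vertex type `V`, pairwise distinct terminals `a b c`, and a HUB GRAPH: every
pair of non-terminal vertices has weight `0` (the hubs may be joined to each terminal and the terminals to each other with
arbitrary weights; all weighted `K_{3,k}`).  With the cells `x = P(abc)`, `s = P(ab|c)`, `t = P(ac|b)`, `u = P(bc|a)` THIS FILE proves

  `(3PT+)   P(abc)·P(¬abc) ≤ P(ac|b) + P(bc|a) + 2·P(abc)·P(ab|c)`   on every hub graph (`threePointPlus_hubGraph`),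

the law-level shadow of prim-l12-p1's fibre inequality `(COMB+)` (`…ThreePointPlusLeFive`: kernel theorem for `n ≤ 5`), which
sharpens THEOREM H (`ThreePointHubGraphs.threePointVariance_hubGraph`, the variance row `(3PT) = (3PT+) + s²` on hub graphs).
Both rows are FALSE on general graphs (prim-l12-p6 gen 22: hub-chain gadgets), so the hub class is a genuine theorem class.

Proof [this work].  `threePointPlus_of_isoIneq` is the cell bookkeeping valid on EVERY finite weighted graph: with the isolation
events `IA = {a↮b, a↮c}`, `IB = {a↮b, b↮c}`, `IC = {a↮c, b↮c}` (pairwise intersections `= IA ∩ IB = sep`),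
`P(abc) = 1 − (P(IA)+P(IB)+P(IC) − 2P(sep))` (inclusion–exclusion), `P(ab|c) ≥ P(IC) − P(sep)`, `P(ac|b) ≥ P(IB) − P(sep)`,
`P(bc|a) ≥ P(IA) − P(sep)`, so `(3PT+)` follows from `2Q − A ≤ (B+C−A)(A+B+C−2Q)` for `Q = P(sep)`, `A = P(IC)`, `B = P(IB)`,
`C = P(IA)`.  On a hub graph `ThreePointHubGraphs` identifies `Q, A, B, C` with products of single-hub factors times terminal-edge
factors (`sep_eq`, `isoA_eq`, `isoB_eq`, `isoC_eq`), and `ThreePointPlusIsoProduct.threePointPlus_hubTriLaw` (hub step = exact LP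
certificate; invariant `(3PT+) ∧ (K_A)`) gives the inequality for such products.
-/

namespace Summit.CriticalPhenomena.PercolationContinuityZ3.Theorems.ThreePointPlusHubGraphs

open MeasureTheory Set
open Literature.Probability.Percolation Literature.Probability.LatticeModels
open Summit.CriticalPhenomena.PercolationContinuityZ3.Theorems.ThreePointHubEvents
open Summit.CriticalPhenomena.PercolationContinuityZ3.Theorems.ThreePointHubGraphs

variable {V : Type*} [Fintype V] [DecidableEq V]

/-- `(3PT+)` from the isolation-coordinate inequality (pure algebra): if `x = 1 − (A+B+C−2Q)`, `0 ≤ x`, the cells dominate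
`A−Q, B−Q, C−Q`, and `2Q − A ≤ (B+C−A)(A+B+C−2Q)`, then `x(1−x) ≤ t + u + 2xs`. [this work] -/
theorem plus_of_iso {Q A B C x s t u : ℝ} (hx : x = 1 - (A + B + C - 2 * Q)) (hx0 : 0 ≤ x) (hs : A - Q ≤ s)
    (ht : B - Q ≤ t) (hu : C - Q ≤ u) (hP : 2 * Q - A ≤ (B + C - A) * (A + B + C - 2 * Q)) :
    x * (1 - x) ≤ t + u + 2 * x * s := by
  have key : (B - Q) + (C - Q) + 2 * x * (A - Q) - x * (1 - x) = (B + C - A) * (A + B + C - 2 * Q) - (2 * Q - A) := by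
    rw [hx]; ring
  nlinarith [mul_le_mul_of_nonneg_left hs hx0, key]

omit [DecidableEq V] in
/-- **Cell bookkeeping for `(3PT+)` (every finite weighted graph).**  With `IA = {a↮b} ∩ {a↮c}`, `IB = {a↮b} ∩ {b↮c}`,
`IC = {a↮c} ∩ {b↮c}` and `Q = P(IA ∩ IB)`, `A = P(IC)`, `B = P(IB)`, `C = P(IA)`: if `2Q − A ≤ (B+C−A)(A+B+C−2Q)` then
`P(abc)·P(¬abc) ≤ P(ac|b) + P(bc|a) + 2·P(abc)·P(ab|c)`. [this work] -/
theorem threePointPlus_of_isoIneq (w : Sym2 V → unitInterval) (a b c : V)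
    (hP : 2 * (prodBernoulli w).real (((openConn a b)ᶜ ∩ (openConn a c)ᶜ) ∩ ((openConn a b)ᶜ ∩ (openConn b c)ᶜ)) -
        (prodBernoulli w).real ((openConn a c)ᶜ ∩ (openConn b c)ᶜ) ≤
      ((prodBernoulli w).real ((openConn a b)ᶜ ∩ (openConn b c)ᶜ) + (prodBernoulli w).real ((openConn a b)ᶜ ∩ (openConn a c)ᶜ) -
          (prodBernoulli w).real ((openConn a c)ᶜ ∩ (openConn b c)ᶜ)) *
        ((prodBernoulli w).real ((openConn a c)ᶜ ∩ (openConn b c)ᶜ) + (prodBernoulli w).real ((openConn a b)ᶜ ∩ (openConn b c)ᶜ) +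
          (prodBernoulli w).real ((openConn a b)ᶜ ∩ (openConn a c)ᶜ) -
          2 * (prodBernoulli w).real (((openConn a b)ᶜ ∩ (openConn a c)ᶜ) ∩ ((openConn a b)ᶜ ∩ (openConn b c)ᶜ)))) :
    (prodBernoulli w).real (openConn a b ∩ openConn a c) * (prodBernoulli w).real (openConn a b ∩ openConn a c)ᶜ ≤
      (prodBernoulli w).real (openConn a c ∩ (openConn a b)ᶜ) + (prodBernoulli w).real (openConn b c ∩ (openConn a b)ᶜ) +
        2 * (prodBernoulli w).real (openConn a b ∩ openConn a c) *
          (prodBernoulli w).real (openConn a b ∩ (openConn a c)ᶜ) := by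
  set μ := prodBernoulli w with hμ
  -- the isolation events
  set IA : Set (BondConfig V) := (openConn a b)ᶜ ∩ (openConn a c)ᶜ with hIA
  set IB : Set (BondConfig V) := (openConn a b)ᶜ ∩ (openConn b c)ᶜ with hIB
  set IC : Set (BondConfig V) := (openConn a c)ᶜ ∩ (openConn b c)ᶜ with hIC
  -- set identities
  have hX : (openConn a b ∩ openConn a c)ᶜ = (IA ∪ IB) ∪ IC := by
    ext ω
    simp only [hIA, hIB, hIC, mem_union, mem_inter_iff, mem_compl_iff]
    constructor
    · intro h
      by_cases hab' : ω ∈ openConn a b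
      · have hac' : ω ∉ openConn a c := fun h' => h ⟨hab', h'⟩
        exact Or.inr ⟨hac', fun hbc' => hac' (SimpleGraph.Reachable.trans hab' hbc')⟩
      · by_cases hac' : ω ∈ openConn a c
        · exact Or.inl (Or.inr ⟨hab', fun hbc' => hab' (SimpleGraph.Reachable.trans hac' (SimpleGraph.Reachable.symm hbc'))⟩)
        · exact Or.inl (Or.inl ⟨hab', hac'⟩)
    · rintro ((⟨h, -⟩ | ⟨h, -⟩) | ⟨h, -⟩) ⟨h1, h2⟩
      · exact h h1
      · exact h h1
      · exact h h2
  have hABC : (IA ∪ IB) ∩ IC = IA ∩ IB := by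
    ext ω
    simp only [hIA, hIB, hIC, mem_union, mem_inter_iff, mem_compl_iff]
    constructor
    · rintro ⟨(⟨h1, h2⟩ | ⟨h1, h2⟩), h3, h4⟩
      · exact ⟨⟨h1, h2⟩, h1, h4⟩
      · exact ⟨⟨h1, h3⟩, h1, h2⟩
    · rintro ⟨⟨h1, h2⟩, -, h3⟩
      exact ⟨Or.inl ⟨h1, h2⟩, h2, h3⟩
  have hCsub : IC ⊆ (openConn a b ∩ (openConn a c)ᶜ) ∪ (IA ∩ IB) := by
    intro ω hω
    obtain ⟨h1, h2⟩ := hω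
    by_cases hab' : ω ∈ openConn a b
    · exact Or.inl ⟨hab', h1⟩
    · exact Or.inr ⟨⟨hab', h1⟩, hab', h2⟩
  have hBsub : IB ⊆ (openConn a c ∩ (openConn a b)ᶜ) ∪ (IA ∩ IB) := by
    intro ω hω
    obtain ⟨h1, h2⟩ := hω
    by_cases hac' : ω ∈ openConn a c
    · exact Or.inl ⟨hac', h1⟩
    · exact Or.inr ⟨⟨h1, hac'⟩, h1, h2⟩
  have hAsub : IA ⊆ (openConn b c ∩ (openConn a b)ᶜ) ∪ (IA ∩ IB) := by
    intro ω hω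
    obtain ⟨h1, h2⟩ := hω
    by_cases hbc' : ω ∈ openConn b c
    · exact Or.inl ⟨hbc', h1⟩
    · exact Or.inr ⟨⟨h1, h2⟩, h1, hbc'⟩
  -- probabilities of the cells in terms of `Q = P(IA ∩ IB)`, `A = P(IC)`, `B = P(IB)`, `C = P(IA)`
  have hU3 : μ.real ((IA ∪ IB) ∪ IC) = μ.real IA + μ.real IB + μ.real IC - 2 * μ.real (IA ∩ IB) := by
    have h1 := measureReal_union_add_inter (μ := μ) (s := IA) (t := IB) MeasurableSet.of_discrete
    have h := measureReal_union_add_inter (μ := μ) (s := IA ∪ IB) (t := IC) MeasurableSet.of_discrete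
    rw [hABC] at h
    linarith
  have hx : μ.real (openConn a b ∩ openConn a c) =
      1 - (μ.real IC + μ.real IB + μ.real IA - 2 * μ.real (IA ∩ IB)) := by
    have h := probReal_compl_eq_one_sub (μ := μ) (s := openConn a b ∩ openConn a c) MeasurableSet.of_discrete
    rw [hX, hU3] at h
    linarith
  have hxc : μ.real (openConn a b ∩ openConn a c)ᶜ = 1 - μ.real (openConn a b ∩ openConn a c) :=
    probReal_compl_eq_one_sub (μ := μ) MeasurableSet.of_discrete
  have hs : μ.real IC - μ.real (IA ∩ IB) ≤ μ.real (openConn a b ∩ (openConn a c)ᶜ) := by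
    have h := (measureReal_mono (μ := μ) hCsub).trans (measureReal_union_le _ _)
    linarith
  have ht : μ.real IB - μ.real (IA ∩ IB) ≤ μ.real (openConn a c ∩ (openConn a b)ᶜ) := by
    have h := (measureReal_mono (μ := μ) hBsub).trans (measureReal_union_le _ _)
    linarith
  have hu : μ.real IA - μ.real (IA ∩ IB) ≤ μ.real (openConn b c ∩ (openConn a b)ᶜ) := by
    have h := (measureReal_mono (μ := μ) hAsub).trans (measureReal_union_le _ _)
    linarith
  rw [hxc]
  exact plus_of_iso (Q := μ.real (IA ∩ IB)) (A := μ.real IC) (B := μ.real IB) (C := μ.real IA) hx measureReal_nonneg hs ht hu hP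

/-- **THEOREM H⁺ — the sharpened three-point row on every hub graph, all weights.**  If every pair of vertices outside
`{a, b, c}` has weight `0`, then
`P(a↔b ∧ a↔c)·P(¬(a↔b ∧ a↔c)) ≤ P(a↔c, a↮b) + P(b↔c, a↮b) + 2·P(a↔b ∧ a↔c)·P(a↔b, a↮c)`. [this work] -/
theorem threePointPlus_hubGraph (w : Sym2 V → unitInterval) {a b c : V} (hab : a ≠ b) (hac : a ≠ c) (hbc : b ≠ c)
    (hw : ∀ u v : V, u ≠ a → u ≠ b → u ≠ c → v ≠ a → v ≠ b → v ≠ c → u ≠ v → (w s(u, v) : ℝ) = 0) :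
    (prodBernoulli w).real (openConn a b ∩ openConn a c) * (prodBernoulli w).real (openConn a b ∩ openConn a c)ᶜ ≤
      (prodBernoulli w).real (openConn a c ∩ (openConn a b)ᶜ) + (prodBernoulli w).real (openConn b c ∩ (openConn a b)ᶜ) +
        2 * (prodBernoulli w).real (openConn a b ∩ openConn a c) *
          (prodBernoulli w).real (openConn a b ∩ (openConn a c)ᶜ) := by
  have hN : (prodBernoulli w).real (bad a b c) = 0 := real_bad w fun u hu v hv huv => by
    obtain ⟨hua, hub, huc⟩ := mem_hubs.1 hu
    obtain ⟨hva, hvb, hvc⟩ := mem_hubs.1 hv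
    exact hw u v hua hub huc hva hvb hvc huv
  refine threePointPlus_of_isoIneq w a b c ?_
  -- weights
  set α : V → ℝ := fun h => (w s(a, h) : ℝ) with hα
  set β : V → ℝ := fun h => (w s(b, h) : ℝ) with hβ
  set γ : V → ℝ := fun h => (w s(c, h) : ℝ) with hγ
  have h01 : ∀ h ∈ hubs a b c, 0 ≤ α h ∧ α h ≤ 1 ∧ 0 ≤ β h ∧ β h ≤ 1 ∧ 0 ≤ γ h ∧ γ h ≤ 1 := fun h _ =>
    ⟨unitInterval.nonneg _, unitInterval.le_one _, unitInterval.nonneg _, unitInterval.le_one _, unitInterval.nonneg _,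
      unitInterval.le_one _⟩
  set pab : ℝ := (w s(a, b) : ℝ)
  set pac : ℝ := (w s(a, c) : ℝ)
  set pbc : ℝ := (w s(b, c) : ℝ)
  have h := ThreePointPlusIsoProduct.threePointPlus_hubTriLaw (hubs a b c) α β γ (pab := pab) (pac := pac) (pbc := pbc)
    (unitInterval.nonneg (w s(a, b))) (unitInterval.le_one (w s(a, b))) (unitInterval.nonneg (w s(a, c)))
    (unitInterval.le_one (w s(a, c))) (unitInterval.nonneg (w s(b, c))) (unitInterval.le_one (w s(b, c))) h01
  simp only at h
  rw [sep_eq w hab hac hbc hN, isoC_eq w hab hac hbc hN, isoB_eq w hab hac hbc hN, isoA_eq w hab hac hbc hN]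
  nlinarith [h]

end Summit.CriticalPhenomena.PercolationContinuityZ3.Theorems.ThreePointPlusHubGraphs
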